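import Summits.KontsevichZagierPeriods.KontsevichZagierPeriods.Theorems.SoloBlindCycFlip
import HarnessLib

/-!
# The min-rotation dissection of the tangent cell: `[T_n, w] = (n+2)·[M_n, w]`

First step of the odd-dimensional (Dirichlet-beta) analogue of `SoloBlindZetaEven`.  The cyclic
tangent cell `T_n = {t ∈ (0,1)ⁿ⁺² | tᵢ + tᵢ₊₁ + tᵢtᵢ₊₁ < 1 (i mod n+2)}` (`cycCell`; in half-angles
`αᵢ = arctan tᵢ`: the polytope `{αᵢ + αᵢ₊₁ < π/4}`) is invariant under the cyclic shift of
coordinates, and so is the angle weight `w = ∏ W(tᵢ)`.  Off the null hyperplanes `{tᵢ = tⱼ}` every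
point has a unique smallest coordinate, so `T_n` dissects (rule (1)) into the `n + 2` cells
`{t ∈ T_n | t_j < tᵢ ∀ i ≠ j}`, each of which is the coordinate rotation (rule (2), a permutation
matrix) of the **min cell**

  `M_n = {t ∈ T_n | t₀ < tᵢ for all i ≠ 0}`   (`minCell`).

Hence `[T_n, w] = (n+2) • [M_n, w]` in `Q` (`mkQ_cycPiece_eq_nsmul_minPiece`).  On `M_n` the two
cyclic conditions through the vertex `0` are implied by the others (`α₀ + α₁ ≤ α₂ + α₁`,
`α_{n+1} + α₀ ≤ α_{n+1} + α_n`), which is what lets the sequel straighten the remaining PATH of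
conditions in every dimension, odd ones included (`SoloBlindFenceChart`).
-/

noncomputable section

open Literature.NumberTheory.Transcendental Literature.NumberTheory.Transcendental.KZ
open Literature.ModelTheory.ExponentialFields
open MeasureTheory Set MvPolynomial

namespace Summit.KontsevichZagierPeriods.KontsevichZagierPeriods.Theorems

namespace SoloBlind

variable {n : ℕ}

/-! ## The min cell -/

/-- The min cell `M_n = {t ∈ T_n | t₀ < tᵢ (i ≠ 0)}`. -/
def minCell (n : ℕ) : Set (Fin (n + 2) → ℝ) :=
  {t | t ∈ cycCell n ∧ ∀ i, i ≠ 0 → t 0 < t i}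

/-- Membership in the min cell. -/
theorem mem_minCell {t : Fin (n + 2) → ℝ} :
    t ∈ minCell n ↔ t ∈ cycCell n ∧ ∀ i, i ≠ 0 → t 0 < t i := Iff.rfl

/-- `M_n ⊆ T_n`. -/
theorem minCell_subset_cycCell : minCell n ⊆ cycCell n := fun _ ht => ht.1

/-- `M_n ⊆ (0,1)ⁿ⁺²`. -/
theorem minCell_subset_kzOpenBox : minCell n ⊆ kzOpenBox (n + 2) :=
  minCell_subset_cycCell.trans cycCell_subset_kzOpenBox

/-- The min cell is `ℚ`-semialgebraic. -/
theorem isSemialgebraic_minCell (n : ℕ) : IsSemialgebraic ℚ (minCell n) := by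
  have h : minCell n = cycCell n ∩ ⋂ i ∈ (Finset.univ.filter (· ≠ 0) : Finset (Fin (n + 2))),
      {t : Fin (n + 2) → ℝ | 0 < aeval t (X i - X 0 : MvPolynomial (Fin (n + 2)) ℚ)} := by
    ext t
    simp only [mem_minCell, Finset.mem_filter, Finset.mem_univ, true_and, mem_inter_iff,
      mem_iInter, mem_setOf_eq, map_sub, MvPolynomial.aeval_X, sub_pos]
  rw [h]
  exact (isSemialgebraic_cycCell n).inter
    (IsSemialgebraic.biInter _ _ fun i _ => isSemialgebraic_setOf_eval_pos _)

/-- `[M_n, w]`: the min cell with the angle weight. -/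
def minPiece (n : ℕ) : IntegralRep (n + 2) :=
  angPiece (minCell n) (isSemialgebraic_minCell n) minCell_subset_kzOpenBox

/-! ## Rotations -/

/-- A power of the cyclic shift is the translation by its value at `0`. -/
theorem finRotate_pow_apply (m : ℕ) (i : Fin (n + 2)) :
    (finRotate (n + 2) ^ m) i = i + (finRotate (n + 2) ^ m) 0 := by
  induction m with
  | zero => simp
  | succ m ih =>
    rw [pow_succ', Equiv.Perm.mul_apply, Equiv.Perm.mul_apply, ih, finRotate_apply,
      finRotate_apply, add_assoc]

/-- `(finRotate)^j 0 = j`. -/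
theorem finRotate_pow_val_apply_zero (j : Fin (n + 2)) : (finRotate (n + 2) ^ j.val) 0 = j := by
  induction j using Fin.induction with
  | zero => simp
  | succ j ih =>
    rw [Fin.val_castSucc] at ih
    rw [Fin.val_succ, pow_succ', Equiv.Perm.mul_apply, ih, finRotate_apply,
      Fin.coeSucc_eq_succ]

/-- The rotation by `j`: `ρ_j i = i + j`. -/
def rot (j : Fin (n + 2)) : Equiv.Perm (Fin (n + 2)) := finRotate (n + 2) ^ j.val

/-- `ρ_j i = i + j`. -/
@[simp] theorem rot_apply (j i : Fin (n + 2)) : rot j i = i + j := by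
  rw [rot, finRotate_pow_apply, finRotate_pow_val_apply_zero]

/-- The tangent cell is rotation invariant. -/
theorem comp_rot_mem_cycCell {t : Fin (n + 2) → ℝ} (j : Fin (n + 2)) :
    (fun i => t (rot j i)) ∈ cycCell n ↔ t ∈ cycCell n := by
  simp only [mem_cycCell, rot_apply]
  constructor
  · intro h i
    have h1 : i - j + j = i := sub_add_cancel i j
    have h2 : i - j + 1 + j = i + 1 := by rw [add_right_comm, sub_add_cancel]
    have := h (i - j)
    rwa [h1, h2] at this
  · intro h i
    have h2 : i + 1 + j = i + j + 1 := add_right_comm i 1 j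
    rw [h2]
    exact h (i + j)

/-! ## The rotated min cells -/

/-- The `j`-th piece: `[M_n, w]` with coordinates rotated by `j` — the cell where `t_j` is
minimal. -/
def minPieceRot (j : Fin (n + 2)) : IntegralRep (n + 2) := (minPiece n).reindex (rot j)

/-- Membership in the `j`-th piece: `t ∈ T_n` and `t_j < tᵢ` for `i ≠ j`. -/
theorem mem_minPieceRot_domain {t : Fin (n + 2) → ℝ} {j : Fin (n + 2)} :
    t ∈ (minPieceRot j).domain ↔ t ∈ cycCell n ∧ ∀ i, i ≠ j → t j < t i := by
  change (fun i => t (rot j i)) ∈ minCell n ↔ _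
  rw [mem_minCell, comp_rot_mem_cycCell]
  simp only [rot_apply, zero_add]
  refine and_congr Iff.rfl ⟨fun h i hi => ?_, fun h i hi => h (i + j) fun h' => hi ?_⟩
  · have := h (i - j) (fun h' => hi (by rw [sub_eq_zero] at h'; exact h'))
    rwa [sub_add_cancel] at this
  · simpa using congrArg (· - j) h'

/-- The integrand of a rotated piece is `w`. -/
theorem minPieceRot_integrand (j : Fin (n + 2)) (t : Fin (n + 2) → ℝ) :
    (minPieceRot j).integrand t = angWeight (n + 2) t := by
  simp only [minPieceRot, IntegralRep.reindex_integrand, minPiece, angPiece_integrand]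
  exact angWeight_perm (rot j) t

/-- Rotated pieces lie in the tangent cell. -/
theorem minPieceRot_domain_subset (j : Fin (n + 2)) : (minPieceRot j).domain ⊆ cycCell n :=
  fun _ ht => (mem_minPieceRot_domain.mp ht).1

/-- Distinct rotated pieces are disjoint (two strict minima). -/
theorem minPieceRot_domain_disjoint {j j' : Fin (n + 2)} (h : j ≠ j') :
    (minPieceRot j).domain ∩ (minPieceRot j').domain = ∅ := by
  ext t
  simp only [mem_inter_iff, mem_empty_iff_false, iff_false, not_and]
  intro hj hj'
  have h1 := (mem_minPieceRot_domain.mp hj).2 j' (Ne.symm h)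
  have h2 := (mem_minPieceRot_domain.mp hj').2 j h
  exact lt_asymm h1 h2

/-- A point of `T_n` with pairwise distinct coordinates lies in the piece of its minimum. -/
theorem exists_mem_minPieceRot {t : Fin (n + 2) → ℝ} (ht : t ∈ cycCell n)
    (hinj : Function.Injective t) : ∃ j, t ∈ (minPieceRot j).domain := by
  obtain ⟨j, _, hj⟩ := Finset.exists_min_image Finset.univ t Finset.univ_nonempty
  exact ⟨j, mem_minPieceRot_domain.mpr ⟨ht, fun i hi =>
    lt_of_le_of_ne (hj i (Finset.mem_univ i)) fun h => hi (hinj h).symm⟩⟩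

/-- Off the tie hyperplanes the rotated pieces cover `T_n`: the rest is null. -/
theorem volume_cycCell_diff_eq_zero :
    volume (cycCell n \ ⋃ j ∈ (Finset.univ : Finset (Fin (n + 2))), (minPieceRot j).domain) =
      0 := by
  refine measure_mono_null ?_
    (measure_iUnion_null_iff.mpr fun p : {p : Fin (n + 2) × Fin (n + 2) // p.1 ≠ p.2} =>
      Literature.Analysis.SpecialFunctions.Selberg.volume_setOf_apply_eq p.2)
  rintro t ⟨ht, hnot⟩
  simp only [Finset.mem_univ, iUnion_true, mem_iUnion, not_exists] at hnot
  by_contra hties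
  simp only [mem_iUnion, mem_setOf_eq, not_exists] at hties
  have hinj : Function.Injective t := fun i j hij => by
    by_contra hne
    exact hties ⟨(i, j), hne⟩ hij
  obtain ⟨j, hj⟩ := exists_mem_minPieceRot ht hinj
  exact hnot j hj

/-- **Dissection (rule (1))**: `[T_n, w] − Σ_j [M_n ∘ ρ_j, w] ∈ relations`. -/
theorem cycPiece_sub_sum_minPieceRot (n : ℕ) :
    of (cycPiece n) - ∑ j ∈ (Finset.univ : Finset (Fin (n + 2))), of (minPieceRot j) ∈
      relations := by
  refine of_sub_sum_of_mem_relations Finset.univ (cycPiece n) minPieceRot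
    (fun j _ => measure_mono_null
      (fun t ht => (ht.2 (minPieceRot_domain_subset j ht.1)).elim) measure_empty)
    (fun j _ t _ => by rw [minPieceRot_integrand, cycPiece, angPiece_integrand]) ?_
    (fun j _ j' _ hjj' => show volume ((minPieceRot j).domain ∩ (minPieceRot j').domain) = 0 by
      rw [minPieceRot_domain_disjoint hjj', measure_empty])
  exact volume_cycCell_diff_eq_zero

/-- Each rotated piece is a coordinate permutation of `[M_n, w]` (rule (2)). -/
theorem minPiece_sub_minPieceRot (j : Fin (n + 2)) :
    of (minPiece n) - of (minPieceRot j) ∈ relations :=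
  of_sub_of_reindex_mem_relations _ _

/-- **`[T_n, w] = (n+2)·[M_n, w]` in `Q`.** -/
theorem mkQ_cycPiece_eq_nsmul_minPiece (n : ℕ) :
    mkQ (of (cycPiece n)) = (n + 2) • mkQ (of (minPiece n)) := by
  have h : ∑ j ∈ (Finset.univ : Finset (Fin (n + 2))), of (minPiece n) -
      ∑ j ∈ (Finset.univ : Finset (Fin (n + 2))), of (minPieceRot j) ∈ relations :=
    sum_sub_sum_mem_relations _ _ _ fun j _ => minPiece_sub_minPieceRot j
  rw [mkQ_eq_mkQ_iff.mpr (cycPiece_sub_sum_minPieceRot n), ← mkQ_eq_mkQ_iff.mpr h,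
    Finset.sum_const, map_nsmul, Finset.card_univ, Fintype.card_fin]

/-! ## What the min cell implies -/

/-- On the min cell, `t₀ + tᵢ + t₀tᵢ < 1` for EVERY `i` (not only the neighbours of `0`):
`α₀ + αᵢ ≤ α_{i−1} + αᵢ < π/4` when `i − 1 ≠ 0`, and the edge condition itself when `i = 1`. -/
theorem add_lt_one_of_mem_minCell {t : Fin (n + 2) → ℝ} (ht : t ∈ minCell n)
    (i : Fin (n + 2)) : t 0 + t i + t 0 * t i < 1 := by
  obtain ⟨hc, hmin⟩ := ht
  by_cases h1 : i - 1 = 0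
  · have hi1 : i = 0 + 1 := by rw [zero_add]; exact (sub_eq_zero.mp h1)
    rw [hi1]
    exact (hc 0).2
  · have hle : t 0 ≤ t (i - 1) := (hmin (i - 1) h1).le
    have h := (hc (i - 1)).2
    rw [sub_add_cancel] at h
    have hi0 : 0 < t i := (hc i).1
    nlinarith

/-- On the min cell every product `t₀tᵢ` is `< 1`. -/
theorem mul_lt_one_of_mem_minCell {t : Fin (n + 2) → ℝ} (ht : t ∈ minCell n) (i : Fin (n + 2)) :
    t 0 * t i < 1 := by
  have h0 := lt_one_of_mem_cycCell ht.1 0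
  have hi := lt_one_of_mem_cycCell ht.1 i
  have := (ht.1 i).1
  nlinarith [(ht.1 0).1]

end SoloBlind

end Summit.KontsevichZagierPeriods.KontsevichZagierPeriods.Theorems
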